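import Literature.NumberTheory.LFunctions.WeilMarkovTwoPrime
import Literature.NumberTheory.LFunctions.WeilFinitePrimeQuadratic
import HarnessLib

/-!
# Window bookkeeping of the Markov form on the `{2,3,4}`-range `log 2 < b ≤ (log 5)/2`

Companion of `WeilMarkovTwoPrime.lean` one prime power further.  In the Markov decomposition
`Re Q(g) = P(g) + 𝓔_b(g) − M_b ‖g‖₂²` of Weil's quadratic functional on a window `[-b, b]`
(`WeilMarkovQuadratic.lean`) the prime powers that enter are indexed by
`weilPrimeIndex b = {n ≤ ⌊e^{2b}⌋ : log n < 2b}`.  On the range `log 2 < b ≤ (log 5)/2` the members carrying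
von Mangoldt weight are exactly `n = 2, 3, 4` (`log n < 2b ≤ log 5` forces `n ≤ 4`; `Λ 0 = Λ 1 = 0`), with
`Λ(2) 2^{-1/2} = log 2/√2`, `Λ(3) 3^{-1/2} = log 3/√3`, `Λ(4) 4^{-1/2} = (log 2)/2`.  Hence

* `M_b = 2 (log 2/√2 + log 3/√3 + (log 2)/2) + 2 ∫₀^∞ (e^{t/2} − 1)/(2 sinh t) dt + log 4π + γ`
  (`weilMarkovConstant_threePrime`; `= M^{(2,3)} + log 2`),
* `𝓔_b(g) = (log 2/√2) D_{log 2}(g) + (log 3/√3) D_{log 3}(g) + ((log 2)/2) D_{log 4}(g) + ∫_{(0,∞)} ρ(t) D_t(g) dt`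
  (`weilDirichletEnergy_threePrime`),
* the Markov form of `Re Q` on the range (`weilQuadratic_re_eq_threePrime`).

This is the window bookkeeping needed by every Rayleigh–Ritz (trial) upper bound and every explicit bilinear energy on the
`{2,3,4}`-window `(log 2, (log 5)/2]` of the parity ladders (route WeilParity item 18085 `stub_tailSimpleEven`, GroundBarta
rung 4), companion of the frequency-side analytic form `weilQuadratic_re_eq_weilThreePrimeQuadratic`
(`WeilFinitePrimeQuadratic.lean`).  Everything here is proved; there are no named facts.

## References

* H. Yoshida, *On Hermitian forms attached to zeta functions*, Adv. Stud. Pure Math. 21 (1992),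
  §2 eq. (2.1) (finitely many primes on a bounded window).
* E. Bombieri, *Remarks on Weil's quadratic functional in the theory of prime numbers I*, Rend.
  Mat. Acc. Lincei (9) 11 (2000), Thm 2 (prime side of the explicit formula).
-/

noncomputable section

open Set MeasureTheory Filter
open scoped Real Topology

namespace Literature.NumberTheory.LFunctions

/-- The prime power `4` enters every window beyond `log 2`: `4 ∈ weilPrimeIndex b` for `log 2 < b`. [folklore] -/
theorem four_mem_weilPrimeIndex {b : ℝ} (hb : Real.log 2 < b) : 4 ∈ weilPrimeIndex b := by
  rw [mem_weilPrimeIndex]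
  have h4 : Real.log 4 = 2 * Real.log 2 := by
    rw [show (4 : ℝ) = 2 ^ 2 by norm_num, Real.log_pow]; push_cast; ring
  push_cast
  rw [h4]
  linarith

/-- `(log 3)/2 < log 2` (`9 < 16`). [folklore] -/
theorem log_three_half_lt_log_two : Real.log 3 / 2 < Real.log 2 := by
  have h : Real.log 9 < Real.log 16 := Real.log_lt_log (by norm_num) (by norm_num)
  have h9 : Real.log 9 = 2 * Real.log 3 := by
    rw [show (9 : ℝ) = 3 ^ 2 by norm_num, Real.log_pow]; push_cast; ring
  have h16 : Real.log 16 = 4 * Real.log 2 := by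
    rw [show (16 : ℝ) = 2 ^ 4 by norm_num, Real.log_pow]; push_cast; ring
  linarith

/-- Below the prime `5` only `n = 2, 3, 4` carry von Mangoldt weight: for `b ≤ (log 5)/2`,
`n ∈ weilPrimeIndex b` with `n ≠ 2, 3, 4` gives `Λ(n) = 0` (`log n < 2b ≤ log 5` forces `n ≤ 4`,
and `Λ 0 = Λ 1 = 0`). [folklore] -/
theorem vonMangoldt_eq_zero_of_mem_weilPrimeIndex_of_le_log_five_half {b : ℝ} (hb : b ≤ Real.log 5 / 2)
    {n : ℕ} (hn : n ∈ weilPrimeIndex b) (h2 : n ≠ 2) (h3 : n ≠ 3) (h4 : n ≠ 4) :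
    (ArithmeticFunction.vonMangoldt n : ℝ) = 0 := by
  rw [mem_weilPrimeIndex] at hn
  rcases Nat.lt_or_ge n 5 with h5 | h5
  · interval_cases n
    · simp
    · simp
    · exact absurd rfl h2
    · exact absurd rfl h3
    · exact absurd rfl h4
  · exfalso
    have hlog : Real.log 5 ≤ Real.log n :=
      Real.log_le_log (by norm_num) (by exact_mod_cast h5)
    linarith

/-- On the `{2,3,4}`-range the prime sum of the window collapses to its `n = 2, 3, 4` terms:
`Σ_{n ∈ weilPrimeIndex b} Λ(n) n^{-1/2} F(n) = (log 2/√2) F(2) + (log 3/√3) F(3) + ((log 2)/2) F(4)` for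
`log 2 < b ≤ (log 5)/2`. [folklore] -/
theorem sum_weilPrimeIndex_eq_threePrime {b : ℝ} (hb : Real.log 2 < b) (hb2 : b ≤ Real.log 5 / 2)
    (F : ℕ → ℝ) :
    ∑ n ∈ weilPrimeIndex b, (ArithmeticFunction.vonMangoldt n : ℝ) / Real.sqrt n * F n =
      Real.log 2 / Real.sqrt 2 * F 2 + Real.log 3 / Real.sqrt 3 * F 3 + Real.log 2 / 2 * F 4 := by
  classical
  have hb3 : Real.log 3 / 2 < b := lt_trans log_three_half_lt_log_two hb
  have h2 := two_mem_weilPrimeIndex_of_log_three_half_lt hb3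
  have h3 := three_mem_weilPrimeIndex hb3
  have h4 := four_mem_weilPrimeIndex hb
  have hsub : ({2, 3, 4} : Finset ℕ) ⊆ weilPrimeIndex b := by
    intro n hn
    simp only [Finset.mem_insert, Finset.mem_singleton] at hn
    rcases hn with rfl | rfl | rfl
    · exact h2
    · exact h3
    · exact h4
  have hsqrt4 : Real.sqrt (4 : ℕ) = 2 := by
    rw [show ((4 : ℕ) : ℝ) = 2 ^ 2 by norm_num, Real.sqrt_sq (by norm_num : (0 : ℝ) ≤ 2)]
  rw [← Finset.sum_subset hsub fun n hn hns ↦ by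
      simp only [Finset.mem_insert, Finset.mem_singleton, not_or] at hns
      rw [vonMangoldt_eq_zero_of_mem_weilPrimeIndex_of_le_log_five_half hb2 hn hns.1 hns.2.1 hns.2.2, zero_div,
        zero_mul],
    Finset.sum_insert (by norm_num), Finset.sum_pair (by norm_num),
    ArithmeticFunction.vonMangoldt_apply_prime Nat.prime_two,
    ArithmeticFunction.vonMangoldt_apply_prime Nat.prime_three, vonMangoldt_four, hsqrt4]
  push_cast
  ring

/-- **The killing constant on the `{2,3,4}`-range.** For `log 2 < b ≤ (log 5)/2`,
`M_b = 2 (log 2/√2 + log 3/√3 + (log 2)/2) + 2 ∫₀^∞ (e^{t/2} − 1)/(2 sinh t) dt + log 4π + γ`. [cite: Bombieri2000Weil, Thm 2 (prime side), restricted to the window [−b, b]] -/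
theorem weilMarkovConstant_threePrime {b : ℝ} (hb : Real.log 2 < b) (hb2 : b ≤ Real.log 5 / 2) :
    weilMarkovConstant b =
      2 * (Real.log 2 / Real.sqrt 2 + Real.log 3 / Real.sqrt 3 + Real.log 2 / 2) +
        2 * (∫ t in Ioi (0 : ℝ), (Real.exp (t / 2) - 1) / (2 * Real.sinh t)) +
        (Real.log (4 * Real.pi) + Real.eulerMascheroniConstant) := by
  have h := sum_weilPrimeIndex_eq_threePrime hb hb2 fun _ ↦ 1
  simp only [mul_one] at h
  unfold weilMarkovConstant
  rw [h]

/-- The killing constants of the two ranges differ by `log 2`: for `(log 3)/2 < b' ≤ log 2 < b ≤ (log 5)/2`,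
`M_b = M_{b'} + log 2`. [folklore] -/
theorem weilMarkovConstant_threePrime_eq_twoPrime_add {b b' : ℝ} (hb : Real.log 2 < b) (hb2 : b ≤ Real.log 5 / 2)
    (hb' : Real.log 3 / 2 < b') (hb'2 : b' ≤ Real.log 2) :
    weilMarkovConstant b = weilMarkovConstant b' + Real.log 2 := by
  rw [weilMarkovConstant_threePrime hb hb2, weilMarkovConstant_twoPrime hb' hb'2]
  ring

/-- **The Dirichlet energy on the `{2,3,4}`-range.** For `log 2 < b ≤ (log 5)/2`,
`𝓔_b(g) = (log 2/√2) D_{log 2}(g) + (log 3/√3) D_{log 3}(g) + ((log 2)/2) D_{log 4}(g) + ∫_{(0,∞)} ρ D_t(g)`. [cite: Bombieri2000Weil, Thm 2 (prime side), restricted to the window [−b, b]] -/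
theorem weilDirichletEnergy_threePrime {b : ℝ} (hb : Real.log 2 < b) (hb2 : b ≤ Real.log 5 / 2)
    (g : ℝ → ℂ) :
    weilDirichletEnergy b g =
      Real.log 2 / Real.sqrt 2 * weilIncrement g (Real.log 2) +
        Real.log 3 / Real.sqrt 3 * weilIncrement g (Real.log 3) +
        Real.log 2 / 2 * weilIncrement g (Real.log 4) +
        ∫ t in Ioi (0 : ℝ), weilArchDensity t * weilIncrement g t := by
  unfold weilDirichletEnergy
  rw [sum_weilPrimeIndex_eq_threePrime hb hb2 fun n ↦ weilIncrement g (Real.log n)]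
  push_cast
  rfl

/-- **Markov form of `Re Q` on the `{2,3,4}`-range**: for a test function `g` with `tsupport g ⊆ [-b, b]`,
`log 2 < b ≤ (log 5)/2`,
`Re Q(g) = P(g) + (log 2/√2) D_{log 2}(g) + (log 3/√3) D_{log 3}(g) + ((log 2)/2) D_{log 4}(g) + ∫_{(0,∞)} ρ D_t(g) − M_b ‖g‖₂²`.
[cite: Bombieri2000Weil, Thm 2; Yoshida1992, §2 eq. (2.1)] -/
theorem weilQuadratic_re_eq_threePrime {g : ℝ → ℂ} (hg : IsWeilTest g) {b : ℝ}
    (hb : Real.log 2 < b) (hb2 : b ≤ Real.log 5 / 2) (hsupp : tsupport g ⊆ Icc (-b) b) :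
    (weilQuadratic g).re =
      weilPoleForm g +
        (Real.log 2 / Real.sqrt 2 * weilIncrement g (Real.log 2) +
          Real.log 3 / Real.sqrt 3 * weilIncrement g (Real.log 3) +
          Real.log 2 / 2 * weilIncrement g (Real.log 4) +
          ∫ t in Ioi (0 : ℝ), weilArchDensity t * weilIncrement g t) -
        weilMarkovConstant b * ∫ x : ℝ, ‖g x‖ ^ 2 := by
  rw [weilQuadratic_re_eq_weilPoleForm_add_weilDirichletEnergy_sub hg hsupp,
    weilDirichletEnergy_threePrime hb hb2]

end Literature.NumberTheory.LFunctions
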